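import Summits.BirchSwinnertonDyer.BirchSwinnertonDyer.Theorems.EisensteinPrimesMazurMCOnX1RankZeroInterludeCoreDescent
import Summits.BirchSwinnertonDyer.BirchSwinnertonDyer.Theorems.EisensteinPrimesMazurMCOnX1RankZeroInterludeRoadBGL1Reduction
import HarnessLib

/-!
# Crux `MazurMCOnX1RankZero` (item stmt-BirchSwinnertonDyer-19035), line `interlude_with_torsion`: the crux BY NAME from the FOUR
# registered stubs of skeleton v10 — road B fed by the residual `GL(1)` finiteness for CONTINUOUS actions (a CONDITIONAL theorem)

Cell `bsd-eis` (host `run/shared/lean/pub/bsd-eis/`), LEAD `cruxlead-19035` (g0); `--supports` stmt-BirchSwinnertonDyer-19035 as a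
HELPER. Companion of `Theorems/…InterludeCoreDescent.lean` (p686428: `mazurMCOnX1RankZero_of_stubs`, five hypotheses = the v8 stub
types). Since then (same day): `stub_roadBResidueP` ((B1c) at degree `p`) became the tree theorem `stub_roadBResidueP` (p687195 ⇐
p687054/p686588), and the ideator bsd-idea-11 g16 observed that road B instantiates (B3) only at `M = E[ψ₀]`, whose Galois action is
CONTINUOUS, so the junk-free, WEAKER input `ResidualGL1FinitenessOddCont` ((B3) with the antecedent «the `Γ_K`-action on `M` is
continuous», `Theorems/…InterludeRoadBGL1Reduction.lean`, where `kerSelmerMapFiniteOfDegreeP_of_residualCont :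
ResidualGL1FinitenessOddCont → KerSelmerMapFiniteOfDegreeP` is proved and the tame input [P23] is a theorem for continuous actions)
suffices. This file records the resulting closure with FOUR hypotheses, token-identical to the stub types of skeleton v10:
`stub_publishedAll`, `stub_goodLatticeBDPValue`, `stub_fourTermSomeLattice`, `stub_residualGL1FinitenessOddCont`.
HONEST FRAMING: CONDITIONAL — crux 2, XI″ (the PRE atom: proof of CGS Prop. 4.2.1 at `α = 𝟙` ⊕ [TF] ⊕ the BSTW24 §5 rider) and
(B3)-cont (print-assembly: Ferrero–Washington + Brumer–Leopoldt / Greenberg's Lemma 5.9 + class field theory; reduced in the tree to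
[P1]-cont ∧ [Cv]-cont, resp. to [Unr] ∧ [Tame] ∧ [Even]) are OPEN; the 15 named facts are refereed print not proved in the tree.
Nothing is proved about any curve; BSD, Mazur's main conjecture and IMC2 are NOT proved.
[cite: CastellaGrossiSkinner2025, §5 (Interlude)] [cite: KellerYin2024, Thm. 3.0.8] [cite: GreenbergLNM1716, §5, Lemma 5.9, Prop. 5.10]
[cite: BurungaleSkinnerTianWan2024, §5] [cite: FerreroWashington1979, Theorem]
-/

set_option linter.dupNamespace false
set_option autoImplicit false

noncomputable section

open Literature.NumberTheory.EllipticCurves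

namespace Summit.BirchSwinnertonDyer.BirchSwinnertonDyer.Theorems.InterludeWithTorsion

/-- **Crux 5 `MazurMCOnX1RankZero` BY NAME, CONDITIONALLY on the four registered stubs of skeleton v10** (`stub_publishedAll`,
`stub_goodLatticeBDPValue`, `stub_fourTermSomeLattice`, `stub_residualGL1FinitenessOddCont`; hypotheses token-identical to their types,
conclusion = the route decl with 0 extra binders): `mazurMCOnX1RankZero_of_stubs` with its road-B hypotheses supplied by the tree
theorem `stub_roadBResidueP`-style bridge `kerSelmerMapFiniteOfDegreeP_of_residualCont hGL1c` (through `RoadBResidueP`'s weakening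
`residualGL1FinitenessOddCont_of_residualGL1FinitenessOdd` is NOT needed: we feed `KerSelmerMapFiniteOfDegreeP` directly into the K2⁺
join). OPEN hypotheses: crux 2, XI″, (B3)-cont. BSD / Mazur's MC / IMC2 are NOT proved by this theorem.
[cite: CastellaGrossiSkinner2025, §5 (Interlude)] [cite: KellerYin2024, Thm. 3.0.8] [cite: GreenbergLNM1716, §5 Prop. 5.10] -/
theorem mazurMCOnX1RankZero_of_stubs_cont
    (hPub : PublishedFacts ∧ PublishedFactsII ∧
      CastellaGrossiSkinner2025.prop342_twoLineEulerChar_trivialChar ∧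
      KobayashiOta2020.prop29_charIdeal_XGr_anticyclotomic_eq_of_isIsogenous)
    (h2 : Summit.BirchSwinnertonDyer.BirchSwinnertonDyer.Theses.EisensteinPrimes.GoodLatticeBDPValue)
    (hXI : PublishedFacts → PublishedFactsII → FourTermAtSomeLattice)
    (hGL1c : ResidualGL1FinitenessOddCont) :
    Summit.BirchSwinnertonDyer.BirchSwinnertonDyer.Theses.EisensteinPrimes.MazurMCOnX1RankZero :=
  have hminus : MinusLineValueClass := minusLineValue_class_of_goodLattice h2 hPub.2.2.2
  mazurMCOnX1RankZero_of_node hPub.1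
    (stepsTwoThree_of_pieces_someLattice (frameData_of_publishedII hPub.2.1)
      (plusCharValue_of_published hPub.1 hPub.2.1 hPub.2.2.1 hminus)
      (xGrCharIdealIsogenyInvariantCyc_of_kerSelmerMapFiniteOfDegreeP (kerSelmerMapFiniteOfDegreeP_of_residualCont hGL1c))
      (crossTransferSome_of_fourTermSome (hXI hPub.1 hPub.2.1)) (isoTransportK_of_published hPub.1) hPub.1 hPub.2.2.1
      hminus)

end Summit.BirchSwinnertonDyer.BirchSwinnertonDyer.Theorems.InterludeWithTorsion

end
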